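import Literature.NumberTheory.Sieve.HeathBrownCubicCubeSums
import Literature.NumberTheory.Sieve.HeathBrownCubicPolar
import Literature.NumberTheory.Sieve.PolynomialCongruencesProofs
import Mathlib.Analysis.SpecialFunctions.Complex.Arg
import Mathlib.Analysis.SpecialFunctions.Trigonometric.Bounds
import HarnessLib

/-!
# Heath-Brown 2001 (PLMS), §8: good cubes cover the shrunk region ((8.4), (8.10)–(8.14))

Topic `Literature/NumberTheory/Sieve`; a PROVED real-analysis layer (definitions with bodies, no named
facts) under the named fact `Irving2015_largestPrimeFactor_cubic` (`LargestPrimeFactorCubic.lean`), part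
of the MAIN TERM `S₀` (this seat; see `…Volume`, `…VolumeGeneral`).  Source: D. R. Heath-Brown, *The
largest prime factor of `X³ + 2`*, Proc. London Math. Soc. (3) 82 (2001) 554–596, §8 pp. 30–34 of the
held text.  The range of the generators is cut "into disjoint cubes `𝓑 = (A, A+M] × (B, B+M] × (C, C+M]`"
and a cube is "good" if it lies inside
`𝓡₀ = {X^{1+3δ/2} < N(x) < X^{1+2δ}, (8.2) (unit window), x₁³ − 2x₂³ > M³}` (p. 30); by (8.4)
"`N(x) = N(x₀) + O(M N(x₀)^{2/3})` for any `x ∈ 𝓑`", and pp. 33–34 show that a point of `𝓡₀` not in a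
good cube lies `O(M)`-close to the boundary: "`μ = X^{1+2δ} + O(X^{1+5δ/3})`" (8.10), (8.11), "the
variable `ν` is restricted to an interval of length `O(X^{−δ/6})`" (8.12), and via
"`x₁³ − 2x₂³ = (2/3√3) r|w − re^{i(θ+2π/3)}|² sin(θ + 2π/3)`" (8.9), "`sin(θ + 2π/3) ≪ M N(x)^{−1/3}`"
(8.13)–(8.14).

This file PROVES the corresponding COVERING statement in the form used for a lower bound: every point
within sup-distance `m` of a point of the SHRUNK box

  `𝓢_η = {N₁(1+η) < N < N₂(1−η), 2(1+η)N^{1/3} < σ₁ < 2E(1−η)N^{1/3}, arg v ∈ (−2π/3 + η, π/3 − η)}`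

(the box of `…VolumeGeneral.genRegion` with those parameters; `σ₁ = ell`, `v = cplxEmb`, `E = unitE`)
lies in the region

  `InBox N₁ N₂ M₃ = {N₁ < N < N₂, 2N^{1/3} < σ₁ < 2E N^{1/3}, M₃ < x₁³ − 2x₂³}`

(`…Region.InRegion X` is `InBox X^{1+3δ/2} X^{1+2δ} X^{1+δ}`), provided
`1404 N₂^{2/3} m ≤ ηN₁/4`, `6000 m ≤ ηN₁^{1/3}` and `M₃ ≤ ηN₁/5000` (**`inBox_of_supClose`**).  Hence the
grid cube of side `m` through any point of `𝓢_η` is good.  Ingredients (all quantitative, explicit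
constants): coordinates `|x_i| ≤ 5N^{1/3}` in the window (`coord_le_of_window`); `|N(y) − N(x)| ≤
1404 N(x)^{2/3} m` (the tree's `CubicSieve.abs_normForm_sub_le`, i.e. (8.4)); `|σ₁(y) − σ₁(x)| ≤ 4m`;
`|N(y)^{1/3} − N(x)^{1/3}| ≤ 1404 m`; `x₁ − ρx₂ = (√3 Re v − Im v)/√3 = 2|v| cos(arg v + π/6)/√3` and
`x₁³ − 2x₂³ = (x₁ − ρx₂)(x₁² + ρx₁x₂ + ρ²x₂²)` with `x₁² + ρx₁x₂ + ρ²x₂² ≥ ¾x₁²` (this is (8.9));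
`cos(arg v + π/6) ≥ sin η ≥ 2η/π` on the shrunk sector; `|v|² = N/σ₁`, so `N^{1/3}/3 < |v| < N^{1/3}/√2`
and `x₁ = (σ₁ + 2 Re v)/3 ≥ N^{1/3}/6` in the window.

## References

* D. R. Heath-Brown, *The largest prime factor of `X³ + 2`*, Proc. London Math. Soc. (3) 82 (2001)
  554–596, §8 pp. 30–34 ((8.1)–(8.2), (8.4), (8.9)–(8.14)). [`HeathBrown2001LargestPrimeFactorCubic`]

## Mathlib / tree search

Tree: `CubicSieve.abs_normForm_sub_le` (`HeathBrownCubicCubeSums`), `abs_coord_le`, `ell`, `quadQ`,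
`ell_mul_quadQ`, `rho`, `rho_pos`, `rho_lt`, `rho_gt`, `unitE`, `one_lt_unitE`, `unitE_lt_four`
(`HeathBrownCubicWindow`), `cplxEmb`, `cplxEmb_re/im`, `normSq_cplxEmb` (`HeathBrownCubicPolar`),
`rpow_third_pow_three` (`PolynomialCongruencesProofs`).
Mathlib: `Complex.norm_mul_cos_arg`, `Complex.norm_mul_sin_arg`, `Complex.normSq_eq_norm_sq`,
`Real.mul_le_sin`, `Real.cos_le_cos_of_nonneg_of_le_pi`, `Real.cos_abs`, `Real.cos_pi_div_two_sub`.
-/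

noncomputable section

open Real

namespace Literature.NumberTheory.Sieve.HeathBrown2001

open CubicSieve

/-! ### The region, the shrunk box, sup-closeness -/

/-- Heath-Brown's region `𝓡₀` with real parameters: `N₁ < N(x) < N₂`, the unit window
`2N^{1/3} < σ₁(x) < 2E N^{1/3}`, and `M₃ < x₁³ − 2x₂³`.
[cite: HeathBrown2001LargestPrimeFactorCubic, §8 p. 30 (𝓡₀: (8.1), (8.2), x₁³ − 2x₂³ > M³)] -/
def InBox (N₁ N₂ M₃ : ℝ) (x : ℝ × ℝ × ℝ) : Prop :=
  N₁ < normForm x ∧ normForm x < N₂ ∧ 2 * (normForm x) ^ ((1 : ℝ) / 3) < ell x ∧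
    ell x < 2 * unitE * (normForm x) ^ ((1 : ℝ) / 3) ∧ M₃ < x.1 ^ 3 - 2 * x.2.1 ^ 3

/-- The shrunk box `𝓢_η` in the coordinates `(N, σ₁/N^{1/3}, arg v)`.
[cite: HeathBrown2001LargestPrimeFactorCubic, §8 pp. 33–34 ((8.10)–(8.14))] -/
def InShrunk (η N₁ N₂ : ℝ) (x : ℝ × ℝ × ℝ) : Prop :=
  N₁ * (1 + η) < normForm x ∧ normForm x < N₂ * (1 - η) ∧
    2 * (1 + η) * (normForm x) ^ ((1 : ℝ) / 3) < ell x ∧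
    ell x < 2 * unitE * (1 - η) * (normForm x) ^ ((1 : ℝ) / 3) ∧
    Complex.arg (cplxEmb x) ∈ Set.Ioo (-(2 * Real.pi / 3) + η) (Real.pi / 3 - η)

/-- Sup-closeness: all coordinates of `y − x` are at most `m` in absolute value. [folklore] -/
def SupClose (m : ℝ) (x y : ℝ × ℝ × ℝ) : Prop :=
  |y.1 - x.1| ≤ m ∧ |y.2.1 - x.2.1| ≤ m ∧ |y.2.2 - x.2.2| ≤ m

/-! ### Cube roots -/

/-- Cube roots are `1404m`-stable under a perturbation of size `Δ ≤ 1404 c² m` of the cube (`c = N^{1/3}`):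
if `|N' − c³| ≤ K c²` with `0 < c`, `0 ≤ N'` then `|N'^{1/3} − c| ≤ K`. [folklore] -/
theorem abs_cbrt_sub_le {N' c K : ℝ} (hc : 0 < c) (hN' : 0 ≤ N') (hK : 0 ≤ K) (h : |N' - c ^ 3| ≤ K * c ^ 2) :
    |N' ^ ((1 : ℝ) / 3) - c| ≤ K := by
  set a := N' ^ ((1 : ℝ) / 3) with ha
  have ha0 : 0 ≤ a := Real.rpow_nonneg hN' _
  have ha3 : a ^ 3 = N' := rpow_third_pow_three hN'
  rw [← ha3] at h
  -- `a³ − c³ = (a − c)(a² + ac + c²)` with `a² + ac + c² ≥ c²`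
  have hfac : a ^ 3 - c ^ 3 = (a - c) * (a ^ 2 + a * c + c ^ 2) := by ring
  have hq : c ^ 2 ≤ a ^ 2 + a * c + c ^ 2 := by nlinarith
  have hq0 : 0 < a ^ 2 + a * c + c ^ 2 := by positivity
  rw [hfac, abs_mul, abs_of_pos hq0] at h
  rw [abs_le]
  have hac := abs_le.mp (show |a - c| ≤ K * c ^ 2 / (a ^ 2 + a * c + c ^ 2) by
    rw [le_div_iff₀ hq0]; exact h)
  have hK' : K * c ^ 2 / (a ^ 2 + a * c + c ^ 2) ≤ K := by
    rw [div_le_iff₀ hq0]; nlinarith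
  constructor <;> linarith [hac.1, hac.2]

/-! ### Size of points in the window -/

/-- In the window `2N^{1/3} < σ₁(x) < 2E N^{1/3}` (`N = N(x) > 0`), with `c = N^{1/3}`:
`|x_i| ≤ 5c`, `|v|² < c²/2`, `|v|² > c²/8` and `x₁ ≥ c/6`.
[cite: HeathBrown2001LargestPrimeFactorCubic, §4 (4.1) ("x₁, x₂, x₃ ≪ N(x)^{1/3}")] -/
theorem window_bounds {x : ℝ × ℝ × ℝ} (hN : 0 < normForm x)
    (h1 : 2 * (normForm x) ^ ((1 : ℝ) / 3) < ell x) (h2 : ell x < 2 * unitE * (normForm x) ^ ((1 : ℝ) / 3)) :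
    (|x.1| ≤ 5 * (normForm x) ^ ((1 : ℝ) / 3) ∧ |x.2.1| ≤ 5 * (normForm x) ^ ((1 : ℝ) / 3) ∧
      |x.2.2| ≤ 5 * (normForm x) ^ ((1 : ℝ) / 3)) ∧
    Complex.normSq (cplxEmb x) < ((normForm x) ^ ((1 : ℝ) / 3)) ^ 2 / 2 ∧
    ((normForm x) ^ ((1 : ℝ) / 3)) ^ 2 / 8 < Complex.normSq (cplxEmb x) ∧
    (normForm x) ^ ((1 : ℝ) / 3) / 6 ≤ x.1 := by
  set c := (normForm x) ^ ((1 : ℝ) / 3) with hc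
  have hc0 : 0 < c := Real.rpow_pos_of_pos hN _
  have hc3 : c ^ 3 = normForm x := rpow_third_pow_three hN.le
  have hE1 := one_lt_unitE
  have hE4 := unitE_lt_four
  have hell0 : 0 < ell x := by linarith [mul_pos two_pos hc0]
  -- `|v|² = quadQ = N/ell`
  have hQ : Complex.normSq (cplxEmb x) = normForm x / ell x := by
    rw [normSq_cplxEmb, eq_div_iff hell0.ne', mul_comm, ell_mul_quadQ]
  have hQlt : Complex.normSq (cplxEmb x) < c ^ 2 / 2 := by
    rw [hQ, ← hc3, div_lt_div_iff₀ hell0 two_pos]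
    nlinarith [mul_pos hc0 hc0]
  have hQgt : c ^ 2 / 8 < Complex.normSq (cplxEmb x) := by
    rw [hQ, ← hc3, div_lt_div_iff₀ (by norm_num) hell0]
    have : ell x < 8 * c := by nlinarith
    nlinarith [mul_pos hc0 hc0]
  have hquad : quadQ x = Complex.normSq (cplxEmb x) := (normSq_cplxEmb x).symm
  -- coordinates via `abs_coord_le` with `R = 5c`
  have hcoord : |x.1| ≤ 5 * c ∧ |x.2.1| ≤ 5 * c ∧ |x.2.2| ≤ 5 * c := by
    refine abs_coord_le (by positivity) ?_
    rw [hquad]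
    have h8 : ell x < 8 * c := by
      have : 2 * unitE * c ≤ 8 * c := by nlinarith
      linarith
    have : ell x ^ 2 < (8 * c) ^ 2 := by
      have h' : 0 < 8 * c - ell x := by linarith
      nlinarith [mul_pos h' (by linarith : 0 < 8 * c + ell x)]
    nlinarith
  -- `x₁ = (ell + 2 Re v)/3 ≥ (2c − 2|v|)/3` and `|v| ≤ Re`-bound: `(Re v)² ≤ |v|² < c²/2`
  have hre : x.1 = (ell x + 2 * (cplxEmb x).re) / 3 := by
    rw [cplxEmb_re]; simp only [ell]; ring
  have hre2 : (cplxEmb x).re ^ 2 ≤ Complex.normSq (cplxEmb x) := by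
    rw [Complex.normSq_apply]; nlinarith [sq_nonneg (cplxEmb x).im]
  have hx1 : c / 6 ≤ x.1 := by
    rw [hre]
    -- `Re v ≥ −|v| ≥ −c/√2 ≥ −0.75 c`
    have h3 : -(3 / 4 * c) ≤ (cplxEmb x).re := by
      by_contra hlt
      push Not at hlt
      have : (3 / 4 * c) ^ 2 < (cplxEmb x).re ^ 2 := by nlinarith
      nlinarith
    nlinarith
  exact ⟨hcoord, hQlt, hQgt, hx1⟩

/-! ### Perturbations at sup-distance `m` -/

/-- `|N(y) − N(x)| ≤ 1404 c² m` if `|x_i| ≤ 5c`, `SupClose m x y`, `m ≤ c` (the tree's Lipschitz bound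
with `R = 6c`). [cite: HeathBrown2001LargestPrimeFactorCubic, §8 (8.4)] -/
theorem abs_normForm_sub_le_of_supClose {x y : ℝ × ℝ × ℝ} {c m : ℝ} (hm : 0 ≤ m) (hmc : m ≤ c)
    (hx : |x.1| ≤ 5 * c ∧ |x.2.1| ≤ 5 * c ∧ |x.2.2| ≤ 5 * c) (hxy : SupClose m x y) :
    |normForm y - normForm x| ≤ 1404 * c ^ 2 * m := by
  obtain ⟨hx1, hx2, hx3⟩ := hx
  obtain ⟨hd1, hd2, hd3⟩ := hxy
  have hy1 : |y.1| ≤ 6 * c := by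
    have := abs_sub_abs_le_abs_sub y.1 x.1; linarith
  have hy2 : |y.2.1| ≤ 6 * c := by
    have := abs_sub_abs_le_abs_sub y.2.1 x.2.1; linarith
  have hy3 : |y.2.2| ≤ 6 * c := by
    have := abs_sub_abs_le_abs_sub y.2.2 x.2.2; linarith
  have hx1' : |x.1| ≤ 6 * c := by linarith [abs_nonneg (y.1 - x.1)]
  have hx2' : |x.2.1| ≤ 6 * c := by linarith [abs_nonneg (y.2.1 - x.2.1)]
  have hx3' : |x.2.2| ≤ 6 * c := by linarith [abs_nonneg (y.2.2 - x.2.2)]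
  have h := abs_normForm_sub_le (x := y) (y := x) (R := 6 * c) (δ := m) ⟨hy1, hy2, hy3⟩ ⟨hx1', hx2', hx3'⟩
    ⟨hd1, hd2, hd3⟩
  calc |normForm y - normForm x| ≤ 39 * (6 * c) ^ 2 * m := h
    _ = 1404 * c ^ 2 * m := by ring

/-- `|σ₁(y) − σ₁(x)| ≤ 4m` under `SupClose m x y` (`1 + ρ + ρ² < 4`). [folklore] -/
theorem abs_ell_sub_le_of_supClose {x y : ℝ × ℝ × ℝ} {m : ℝ} (hxy : SupClose m x y) :
    |ell y - ell x| ≤ 4 * m := by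
  obtain ⟨hd1, hd2, hd3⟩ := hxy
  have hm : 0 ≤ m := (abs_nonneg _).trans hd1
  have hr := rho_pos
  have hr2 := rho_lt
  have e : ell y - ell x = (y.1 - x.1) + rho * (y.2.1 - x.2.1) + rho ^ 2 * (y.2.2 - x.2.2) := by
    simp only [ell]; ring
  rw [e]
  calc |(y.1 - x.1) + rho * (y.2.1 - x.2.1) + rho ^ 2 * (y.2.2 - x.2.2)|
      ≤ |y.1 - x.1| + |rho * (y.2.1 - x.2.1)| + |rho ^ 2 * (y.2.2 - x.2.2)| := abs_add_three _ _ _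
    _ = |y.1 - x.1| + rho * |y.2.1 - x.2.1| + rho ^ 2 * |y.2.2 - x.2.2| := by
        rw [abs_mul, abs_mul, abs_of_pos hr, abs_of_pos (pow_pos hr 2)]
    _ ≤ m + rho * m + rho ^ 2 * m := by gcongr
    _ ≤ 4 * m := by
        have hsum : 1 + rho + rho ^ 2 ≤ 4 := by nlinarith
        nlinarith [mul_le_mul_of_nonneg_right hsum hm]

/-- `|(y₁ − ρy₂) − (x₁ − ρx₂)| ≤ 3m` under `SupClose m x y`. [folklore] -/
theorem abs_lin_sub_le_of_supClose {x y : ℝ × ℝ × ℝ} {m : ℝ} (hxy : SupClose m x y) :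
    |(y.1 - rho * y.2.1) - (x.1 - rho * x.2.1)| ≤ 3 * m := by
  obtain ⟨hd1, hd2, -⟩ := hxy
  have hm : 0 ≤ m := (abs_nonneg _).trans hd1
  have hr := rho_pos
  have hr2 := rho_lt
  have e : (y.1 - rho * y.2.1) - (x.1 - rho * x.2.1) = (y.1 - x.1) - rho * (y.2.1 - x.2.1) := by ring
  rw [e]
  calc |(y.1 - x.1) - rho * (y.2.1 - x.2.1)| ≤ |y.1 - x.1| + |rho * (y.2.1 - x.2.1)| := abs_sub _ _
    _ = |y.1 - x.1| + rho * |y.2.1 - x.2.1| := by rw [abs_mul, abs_of_pos hr]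
    _ ≤ m + rho * m := by gcongr
    _ ≤ 3 * m := by nlinarith [mul_le_mul_of_nonneg_right hr2.le hm]

/-! ### The cubic `x₁³ − 2x₂³` through the complex embedding ((8.9)) -/

/-- `x₁³ − 2x₂³ = (x₁ − ρx₂)(x₁² + ρx₁x₂ + ρ²x₂²)` and the quadratic factor is `≥ ¾x₁²`. [folklore] -/
theorem cubic_factor (x₁ x₂ : ℝ) :
    x₁ ^ 3 - 2 * x₂ ^ 3 = (x₁ - rho * x₂) * (x₁ ^ 2 + rho * x₁ * x₂ + rho ^ 2 * x₂ ^ 2) ∧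
      3 / 4 * x₁ ^ 2 ≤ x₁ ^ 2 + rho * x₁ * x₂ + rho ^ 2 * x₂ ^ 2 := by
  have h := rho_pow_three
  constructor
  · linear_combination x₂ ^ 3 * h
  · nlinarith [sq_nonneg (rho * x₂ + x₁ / 2)]

/-- `x₁ − ρx₂ = (√3 Re v − Im v)/√3`, `v = cplxEmb x`. [cite: HeathBrown2001LargestPrimeFactorCubic, §8 (8.9)] -/
theorem fst_sub_rho_mul_eq (x : ℝ × ℝ × ℝ) :
    x.1 - rho * x.2.1 = (Real.sqrt 3 * (cplxEmb x).re - (cplxEmb x).im) / Real.sqrt 3 := by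
  have h3 : Real.sqrt 3 ≠ 0 := (Real.sqrt_pos.mpr (by norm_num)).ne'
  have key : Real.sqrt 3 * (cplxEmb x).re - (cplxEmb x).im = Real.sqrt 3 * (x.1 - rho * x.2.1) := by
    rw [cplxEmb_re, cplxEmb_im]; ring
  rw [key]
  field_simp

/-- `√3 Re v − Im v = 2|v| cos(arg v + π/6)`. [cite: HeathBrown2001LargestPrimeFactorCubic, §8 (8.9)] -/
theorem sqrt3_re_sub_im_eq (v : ℂ) :
    Real.sqrt 3 * v.re - v.im = 2 * ‖v‖ * Real.cos (Complex.arg v + Real.pi / 6) := by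
  rw [Real.cos_add, Real.cos_pi_div_six, Real.sin_pi_div_six, ← Complex.norm_mul_cos_arg v,
    ← Complex.norm_mul_sin_arg v]
  ring

/-- On the shrunk sector: `arg v ∈ (−2π/3 + η, π/3 − η)` (`η ≥ 0`) gives `cos(arg v + π/6) ≥ sin η`. [cite: HeathBrown2001LargestPrimeFactorCubic, §8 (8.14)] -/
theorem sin_le_cos_arg_add {v : ℂ} {η : ℝ} (hη : 0 ≤ η)
    (harg : Complex.arg v ∈ Set.Ioo (-(2 * Real.pi / 3) + η) (Real.pi / 3 - η)) :
    Real.sin η ≤ Real.cos (Complex.arg v + Real.pi / 6) := by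
  set t := Complex.arg v + Real.pi / 6 with ht
  obtain ⟨h1, h2⟩ := harg
  have ht1 : -(Real.pi / 2 - η) < t := by rw [ht]; linarith
  have ht2 : t < Real.pi / 2 - η := by rw [ht]; linarith
  have habs : |t| ≤ Real.pi / 2 - η := abs_le.mpr ⟨ht1.le, ht2.le⟩
  rw [← Real.cos_abs t, ← Real.cos_pi_div_two_sub]
  exact Real.cos_le_cos_of_nonneg_of_le_pi (abs_nonneg t) (by linarith [Real.pi_pos, hη]) habs

/-- `sin η ≥ 2η/π ≥ η/2` for `0 ≤ η ≤ π/2`. [folklore] -/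
theorem half_le_sin {η : ℝ} (hη : 0 ≤ η) (hη2 : η ≤ Real.pi / 2) : η / 2 ≤ Real.sin η := by
  have h := Real.mul_le_sin hη hη2
  have hπ : 2 / Real.pi ≥ 1 / 2 := by
    rw [ge_iff_le, div_le_div_iff₀ (by norm_num) Real.pi_pos]
    linarith [Real.pi_lt_four]
  nlinarith

/-! ### The covering statement -/

set_option maxHeartbeats 1600000 in
/-- **Good cubes cover the shrunk box**: if `x ∈ 𝓢_η` and `y` is `m`-sup-close to `x`, then
`y ∈ InBox N₁ N₂ M₃`, provided `0 < N₁ ≤ N₂`, `0 < η ≤ 1/2`, `0 < m` and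
`1404 N₂^{2/3} m ≤ ηN₁/4`, `6000 m ≤ η N₁^{1/3}`, `M₃ ≤ ηN₁/5000`.
[cite: HeathBrown2001LargestPrimeFactorCubic, §8 pp. 33–34 ((8.10)–(8.14))] -/
theorem inBox_of_supClose {N₁ N₂ M₃ η m : ℝ} (hN₁ : 0 < N₁) (hN : N₁ ≤ N₂) (hη : 0 < η) (hη1 : η ≤ 1 / 2)
    (hm : 0 < m)
    (C1 : 1404 * N₂ ^ ((2 : ℝ) / 3) * m ≤ η * N₁ / 4)
    (C2 : 6000 * m ≤ η * N₁ ^ ((1 : ℝ) / 3))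
    (C3 : M₃ ≤ η * N₁ / 5000)
    {x y : ℝ × ℝ × ℝ} (hx : InShrunk η N₁ N₂ x) (hxy : SupClose m x y) : InBox N₁ N₂ M₃ y := by
  obtain ⟨hxN1, hxN2, hw1, hw2, harg⟩ := hx
  have hE1 := one_lt_unitE
  have hE4 := unitE_lt_four
  have hE0 : (0 : ℝ) < unitE := by linarith
  have hπ3 := Real.pi_gt_three
  -- scales (rewrite `N₂^{2/3} = (N₂^{1/3})²` before abbreviating)
  have hN₂ : 0 < N₂ := hN₁.trans_le hN
  have hT2 : N₂ ^ ((2 : ℝ) / 3) = (N₂ ^ ((1 : ℝ) / 3)) ^ 2 := by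
    rw [← Real.rpow_natCast, ← Real.rpow_mul hN₂.le]; norm_num
  rw [hT2] at C1
  set t := N₁ ^ ((1 : ℝ) / 3) with htdef
  set T := N₂ ^ ((1 : ℝ) / 3) with hTdef
  have ht0 : 0 < t := Real.rpow_pos_of_pos hN₁ _
  have hT0 : 0 < T := Real.rpow_pos_of_pos hN₂ _
  have hηN₁ : 0 < η * N₁ := mul_pos hη hN₁
  -- the norm of `x` and `c = N(x)^{1/3}`
  have e1 : N₁ * (1 + η) = N₁ + η * N₁ := by ring
  have e2 : N₂ * (1 - η) = N₂ - η * N₂ := by ring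
  have hηN : η * N₁ ≤ η * N₂ := mul_le_mul_of_nonneg_left hN hη.le
  have hNx : 0 < normForm x := by linarith
  have hN₁x : N₁ ≤ normForm x := by linarith
  have hxN₂ : normForm x ≤ N₂ := by
    have : 0 ≤ η * N₂ := by positivity
    linarith
  set c := (normForm x) ^ ((1 : ℝ) / 3) with hcdef
  have hc0 : 0 < c := Real.rpow_pos_of_pos hNx _
  have hc3 : c ^ 3 = normForm x := rpow_third_pow_three hNx.le
  have htc : t ≤ c := by
    rw [htdef, hcdef]; exact Real.rpow_le_rpow hN₁.le hN₁x (by norm_num)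
  have hcT : c ≤ T := by
    rw [hTdef, hcdef]; exact Real.rpow_le_rpow hNx.le hxN₂ (by norm_num)
  have hηc0 : 0 ≤ η * c := by positivity
  -- `x` lies in the (unshrunk) window
  have e3 : 2 * (1 + η) * c = 2 * c + 2 * (η * c) := by ring
  have e4 : 2 * unitE * (1 - η) * c = 2 * unitE * c - 2 * (unitE * (η * c)) := by ring
  have hEηc0 : 0 ≤ unitE * (η * c) := by positivity
  have hw1' : 2 * c < ell x := by linarith
  have hw2' : ell x < 2 * unitE * c := by linarith
  obtain ⟨hcoord, hQlt, hQgt, hx1⟩ := window_bounds hNx hw1' hw2'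
  -- `m` is small
  have hηt : η * t ≤ 1 / 2 * t := mul_le_mul_of_nonneg_right hη1 ht0.le
  have hmt : 6000 * m ≤ t / 2 := by linarith
  have hmc : m ≤ c := by linarith
  have hηc : 6000 * m ≤ η * c := C2.trans (mul_le_mul_of_nonneg_left htc hη.le)
  -- the perturbation of `N`
  have hΔ := abs_normForm_sub_le_of_supClose hm.le hmc hcoord hxy
  have hc2T2 : c ^ 2 ≤ T ^ 2 := pow_le_pow_left₀ hc0.le hcT 2
  have hΔ' : 1404 * c ^ 2 * m ≤ η * N₁ / 4 := by
    have : 1404 * c ^ 2 * m ≤ 1404 * T ^ 2 * m := by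
      have := mul_le_mul_of_nonneg_right hc2T2 hm.le
      linarith
    linarith
  obtain ⟨hΔ1, hΔ2⟩ := abs_le.mp hΔ
  have hyN1 : N₁ < normForm y := by linarith
  have hyN2 : normForm y < N₂ := by linarith
  have hNy : 0 < normForm y := hN₁.trans hyN1
  -- the cube root of `N(y)`
  set c' := (normForm y) ^ ((1 : ℝ) / 3) with hc'def
  have hcc' : |c' - c| ≤ 1404 * m := by
    refine abs_cbrt_sub_le hc0 hNy.le (by positivity) ?_
    rw [hc3]
    calc |normForm y - normForm x| ≤ 1404 * c ^ 2 * m := hΔ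
      _ = 1404 * m * c ^ 2 := by ring
  obtain ⟨hcc1, hcc2⟩ := abs_le.mp hcc'
  -- the window for `y`
  obtain ⟨hell1, hell2⟩ := abs_le.mp (abs_ell_sub_le_of_supClose hxy)
  have hwy1 : 2 * c' < ell y := by linarith
  have hEm : unitE * m ≤ 4 * m := mul_le_mul_of_nonneg_right hE4.le hm.le
  have hEηc : η * c ≤ unitE * (η * c) := le_mul_of_one_le_left hηc0 hE1.le
  have hEc' : 2 * unitE * (c - 1404 * m) ≤ 2 * unitE * c' :=
    mul_le_mul_of_nonneg_left (by linarith) (by positivity)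
  have e5 : 2 * unitE * (c - 1404 * m) = 2 * unitE * c - 2808 * (unitE * m) := by ring
  have hwy2 : ell y < 2 * unitE * c' := by linarith
  -- the cubic condition for `y`
  obtain ⟨hfac, hquad⟩ := cubic_factor y.1 y.2.1
  obtain ⟨hlin1, -⟩ := abs_le.mp (abs_lin_sub_le_of_supClose hxy)
  have h3pos : 0 < Real.sqrt 3 := Real.sqrt_pos.mpr (by norm_num)
  have hs3 : Real.sqrt 3 ^ 2 = 3 := Real.sq_sqrt (by norm_num)
  have hs3lt : Real.sqrt 3 ≤ 2 := by
    rw [show (2 : ℝ) = Real.sqrt 4 by rw [show (4:ℝ) = 2 ^ 2 by norm_num, Real.sqrt_sq (by norm_num)]]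
    exact Real.sqrt_le_sqrt (by norm_num)
  have hv2 : ‖cplxEmb x‖ ^ 2 = Complex.normSq (cplxEmb x) := (Complex.normSq_eq_norm_sq _).symm
  have hc2 : 0 < c ^ 2 := by positivity
  have hvpos : c / 3 ≤ ‖cplxEmb x‖ := by
    by_contra hlt
    push Not at hlt
    have h1 : ‖cplxEmb x‖ ^ 2 ≤ (c / 3) ^ 2 := pow_le_pow_left₀ (norm_nonneg _) hlt.le 2
    have h2 : (c / 3) ^ 2 = c ^ 2 / 9 := by ring
    linarith
  have hηπ : η ≤ Real.pi / 2 := by linarith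
  have hcos := sin_le_cos_arg_add hη.le harg
  have hsin := half_le_sin hη.le hηπ
  have hcos' : η / 2 ≤ Real.cos (Complex.arg (cplxEmb x) + Real.pi / 6) := hsin.trans hcos
  have hlinx : η * c / 12 ≤ x.1 - rho * x.2.1 := by
    rw [fst_sub_rho_mul_eq, sqrt3_re_sub_im_eq, le_div_iff₀ h3pos]
    have hprod : c / 3 * (η / 2) ≤ ‖cplxEmb x‖ * Real.cos (Complex.arg (cplxEmb x) + Real.pi / 6) :=
      mul_le_mul hvpos hcos' (by positivity) (norm_nonneg _)
    have hleft : η * c / 12 * Real.sqrt 3 ≤ η * c / 12 * 2 := mul_le_mul_of_nonneg_left hs3lt (by positivity)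
    have e6 : c / 3 * (η / 2) = η * c / 6 := by ring
    linarith
  have hliny : η * c / 24 ≤ y.1 - rho * y.2.1 := by linarith
  have hy1 : c / 12 ≤ y.1 := by
    obtain ⟨hd1, -, -⟩ := hxy
    have := (abs_le.mp hd1).1
    linarith
  have hquad' : 3 / 4 * (c / 12) ^ 2 ≤ y.1 ^ 2 + rho * y.1 * y.2.1 + rho ^ 2 * y.2.1 ^ 2 := by
    have : (c / 12) ^ 2 ≤ y.1 ^ 2 := pow_le_pow_left₀ (by positivity) hy1 2
    linarith
  have hcubic : M₃ < y.1 ^ 3 - 2 * y.2.1 ^ 3 := by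
    rw [hfac]
    have h1 : η * c / 24 * (3 / 4 * (c / 12) ^ 2) ≤
        (y.1 - rho * y.2.1) * (y.1 ^ 2 + rho * y.1 * y.2.1 + rho ^ 2 * y.2.1 ^ 2) :=
      mul_le_mul hliny hquad' (by positivity) (le_trans (by positivity) hliny)
    have h2 : η * c / 24 * (3 / 4 * (c / 12) ^ 2) = η * c ^ 3 / 4608 := by ring
    have h3 : η * N₁ ≤ η * c ^ 3 := by rw [hc3]; exact mul_le_mul_of_nonneg_left hN₁x hη.le
    have h4 : M₃ < η * N₁ / 4608 := by linarith
    linarith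
  exact ⟨hyN1, hyN2, hwy1, hwy2, hcubic⟩

end Literature.NumberTheory.Sieve.HeathBrown2001
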